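import Literature.MathematicalPhysics.QuantumLattice.TorusSectorPressureTypeBound
import Literature.MathematicalPhysics.QuantumLattice.HubbardTorusMarkovRectWindow
import HarnessLib

/-!
# Certified TWO-SIDED thermal energy windows along the temperature axis from certified pressure bounds:
# the type-class lower bound (C2) at `β` and Markov upper bounds (C1) at `β_h < β < β_c`

Family `hubbard` (topic `MathematicalPhysics/QuantumLattice`). The free-energy route of the `hubbard-thermal`
programme produces, per inverse temperature, a certified LOWER bound on the canonical (sector) pressure —
`TorusSectorPressureTypeBound.lean` (certificate C2: `∀ ε > 0`, eventually `(W − ε) L² ≤ log Z_β^{sector}`) —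
and a certified UPPER bound — `HubbardTorusMarkovClusterPressureTorusLimit.lean` (certificate C1: `∀ ε > 0`,
eventually `log Z_{β'}^{sector} ≤ (c − β' μ n + ε) L²`). By convexity of `β ↦ log Z_β` (the chords of
`TorusSectorGibbsEnergyWindow.lean`) these bound the thermal energy density of every torus limit `ω` of the
canonical sector Gibbs states at `β` FROM BOTH SIDES:

* §1 `ε`-management: `IsTorusLimitOfMixture.meanEnergy_hubbardTTPrime_le_of_eventually_pressure_bounds`
  (`W ≤ p(β)` certified at `β`, `p(β_h) ≤ u_h` at `β_h < β` ⇒ `e_Φ(ω) ≤ (u_h − W)/(β − β_h)`) and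
  `IsTorusLimitOfMixture.le_meanEnergy_hubbardTTPrime_of_eventually_pressure_bounds`
  (`p(β_c) ≤ u_c` at `β_c > β` ⇒ `(W − u_c)/(β_c − β) ≤ e_Φ(ω)`);
* §2 instantiated with the certificates: `…le_of_typeClass_of_rectMarkovCertificate` (C2 at `β`, C1 on a
  rectangle at `β_h`, `t' = 0`) and `…ge_of_typeClass_of_rectMarkovCertificate` (C2 at `β`, C1 at `β_c`):
  for torus limits along box-compatible tori, the only hypotheses are the finite-dimensional certificate
  data (box partition-function floors `z_s`, the PSD dual check) — the temperature-AXIS cells of the phase map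
  (`D-0099`) in the energy observable.

[cite: Israel1979, Lemma II.3.1] (Gibbs variational principle / convexity chords); [cite: Ruelle1969, §3.3]
(sub-box trial states); [cite: PoulinHastings2011, eqs. (3)–(8)] (Markov upper bound). Everything is PROVED;
no definition, no named fact.
-/

noncomputable section

namespace Literature.MathematicalPhysics.QuantumLattice

open Matrix Finset HubbardWave0 ThermodynamicLimit LiebThm1 AndersonCluster Literature.Probability.LatticeModels
open _root_.Filter
open scoped _root_.Topology ComplexOrder BigOperators

namespace InfVolFermionState

variable {t t' U n β : ℝ} {ω : InfVolFermionState 2} {Ls : ℕ → ℕ}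

/-! ### §1 Two-sided chords from `ε`-certified pressure bounds -/

/-- **Upper edge from a pressure floor at `β` and a pressure ceiling at a hotter `β_h`.** Let `ω` be a
torus limit of the canonical sector Gibbs states at `β` along `Ls → ∞` (`0 ≤ n ≤ 2`), `0 < β_h < β`. If for
every `ε > 0` eventually `(W − ε) L² ≤ log Z_β^{sector}(L)` and `log Z_{β_h}^{sector}(L) ≤ (u + ε) L²`, then
`e_Φ(ω) ≤ (u − W)/(β − β_h)`. [cite: Israel1979, Lemma II.3.1] -/
theorem IsTorusLimitOfMixture.meanEnergy_hubbardTTPrime_le_of_eventually_pressure_bounds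
    (hn0 : 0 ≤ n) (hn2 : n ≤ 2)
    (h : ω.IsTorusLimitOfMixture (sectorGibbsCount n) (fun L => sectorGibbsWeightTT' β t t' U n L)
      (fun L => sectorGibbsVectorTT' t t' U n L) Ls)
    (hLs : Tendsto Ls atTop atTop) {βh W u : ℝ} (hβh : 0 < βh) (hlt : βh < β)
    (hW : ∀ ε : ℝ, 0 < ε → ∀ᶠ j in atTop,
      (W - ε) * (Ls j : ℝ) ^ 2 ≤ Real.log (partitionFn β (sectorHamiltonianTT' t t' U n (Ls j))).re)
    (hu : ∀ ε : ℝ, 0 < ε → ∀ᶠ j in atTop,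
      Real.log (partitionFn βh (sectorHamiltonianTT' t t' U n (Ls j))).re ≤ (u + ε) * (Ls j : ℝ) ^ 2) :
    ω.meanEnergy (hubbardTTPrimeFermionInteraction t t' U) 1 ≤ (u - W) / (β - βh) := by
  have hd : 0 < β - βh := sub_pos.2 hlt
  refine le_of_forall_pos_le_add fun δ hδ => ?_
  have hε : 0 < δ * (β - βh) / 2 := by positivity
  refine (IsTorusLimitOfMixture.meanEnergy_hubbardTTPrime_le_chord_of_sectorGibbs hn0 hn2 h hLs hβh hlt
    (hW _ hε) (hu _ hε)).trans (le_of_eq ?_)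
  have hd' : β - βh ≠ 0 := hd.ne'
  field_simp
  ring

/-- **Lower edge from a pressure floor at `β` and a pressure ceiling at a colder `β_c`.** With `ω` as
above, `0 < β < β_c`: if for every `ε > 0` eventually `(W − ε) L² ≤ log Z_β^{sector}(L)` and
`log Z_{β_c}^{sector}(L) ≤ (u + ε) L²`, then `(W − u)/(β_c − β) ≤ e_Φ(ω)`. [cite: Israel1979, Lemma II.3.1] -/
theorem IsTorusLimitOfMixture.le_meanEnergy_hubbardTTPrime_of_eventually_pressure_bounds
    (hn0 : 0 ≤ n) (hn2 : n ≤ 2)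
    (h : ω.IsTorusLimitOfMixture (sectorGibbsCount n) (fun L => sectorGibbsWeightTT' β t t' U n L)
      (fun L => sectorGibbsVectorTT' t t' U n L) Ls)
    (hLs : Tendsto Ls atTop atTop) {βc W u : ℝ} (hβ : 0 < β) (hlt : β < βc)
    (hW : ∀ ε : ℝ, 0 < ε → ∀ᶠ j in atTop,
      (W - ε) * (Ls j : ℝ) ^ 2 ≤ Real.log (partitionFn β (sectorHamiltonianTT' t t' U n (Ls j))).re)
    (hu : ∀ ε : ℝ, 0 < ε → ∀ᶠ j in atTop,
      Real.log (partitionFn βc (sectorHamiltonianTT' t t' U n (Ls j))).re ≤ (u + ε) * (Ls j : ℝ) ^ 2) :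
    (W - u) / (βc - β) ≤ ω.meanEnergy (hubbardTTPrimeFermionInteraction t t' U) 1 := by
  have hd : 0 < βc - β := sub_pos.2 hlt
  refine le_of_forall_pos_le_add fun δ hδ => ?_
  have hε : 0 < δ * (βc - β) / 2 := by positivity
  have hch := IsTorusLimitOfMixture.chord_le_meanEnergy_hubbardTTPrime_of_sectorGibbs hn0 hn2 h hLs hβ hlt
    (hW _ hε) (hu _ hε)
  have heq : (W - δ * (βc - β) / 2 - (u + δ * (βc - β) / 2)) / (βc - β) = (W - u) / (βc - β) - δ := by
    have hd' : βc - β ≠ 0 := hd.ne'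
    field_simp
    ring
  rw [heq] at hch
  linarith

/-! ### §2 The certificates: C2 (type class) at `β`, C1 (Markov, rectangle, `t' = 0`) at `β_h` or `β_c` -/

/-- **Upper edge of the thermal energy window from a C2 certificate at `β` and a C1 certificate at
`β_h < β`** (square-lattice Hubbard model, `t' = 0`, `0 ≤ n ≤ 2`). C2 data (`TorusSectorPressureTypeBound`):
box `a × b`, sectors `S`, balanced base type `m` (`Σ m_s = q`, `Σ m_s a_s = Σ m_s b_s = A₀`), floors
`0 < z_s ≤ Re Z_β(H^open_{a×b}; s)`; the torus limit `ω` is taken along box-compatible tori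
(`Ls j = K_x a = K_y b`, `K_x K_y = R q`, `halfRectN n (Ls j) = R A₀`). C1 data (`HubbardTorusMarkovRectWindow`):
rectangle `a' × b'` (`a', b' ≥ 2`) at `(β_h, μ)` with annihilator, dual `L_B` and constant `c`. Then
`e_Φ(ω) ≤ ((c − β_h μ n) − W)/(β − β_h)`, `W = (q log q − Σ m_s log m_s + Σ m_s log z_s)/(q a b)`.
[cite: Israel1979, Lemma II.3.1] [cite: PoulinHastings2011, eqs. (3)–(8)] [cite: Ruelle1969, §3.3] -/
theorem IsTorusLimitOfMixture.meanEnergy_hubbardTTPrime_le_of_typeClass_of_rectMarkovCertificate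
    (hn0 : 0 ≤ n) (hn2 : n ≤ 2)
    (h : ω.IsTorusLimitOfMixture (sectorGibbsCount n) (fun L => sectorGibbsWeightTT' β t 0 U n L)
      (fun L => sectorGibbsVectorTT' t 0 U n L) Ls)
    (hLs : Tendsto Ls atTop atTop) {βh : ℝ} (hβh : 0 < βh) (hlt : βh < β)
    -- C2 at `β`
    {a b : ℕ} (ha : 1 ≤ a) (hb : 1 ≤ b) (S : Finset (ℕ × ℕ)) (m : ℕ × ℕ → ℕ) {q A₀ : ℕ} (hq : 1 ≤ q)
    (hmS : ∀ s, m s ≠ 0 → s ∈ S) (hsum : ∑ s ∈ S, m s = q) (hA : ∑ s ∈ S, m s * s.1 = A₀)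
    (hB : ∑ s ∈ S, m s * s.2 = A₀) {z : ℕ × ℕ → ℝ} (hz0 : ∀ s ∈ S, 0 < z s)
    (hz : ∀ s ∈ S, z s ≤ (partitionFn β (spinSectorHamiltonian s.1 s.2 (hubbardOpenBoxTT' a b t 0 U))).re)
    (hbox : ∀ᶠ j in atTop, ∃ R Kx Ky : ℕ, 2 ≤ Kx ∧ 2 ≤ Ky ∧ Ls j = Kx * a ∧ Ls j = Ky * b ∧
      Kx * Ky = R * q ∧ halfRectN n (Ls j) = R * A₀)
    -- C1 at `βh`
    (μ : ℝ) {a' b' : ℕ} (ha' : 2 ≤ a') (hb' : 2 ≤ b')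
    {ι : Type*} (sι : Finset ι) (Sw : ι → Finset (Site 2)) (hS : ∀ i, Sw i ⊆ rectWindow a' b') (zw : ι → Site 2)
    (hzw : ∀ i, shiftSet (zw i) (Sw i) ⊆ rectWindow a' b') {O : ∀ i, FermionOp (Sw i)}
    (hO : ∀ i ∈ sι, (O i).IsHermitian) (g : ι → ℝ)
    {LB : FermionOp ((rectWindow a' b').erase (mkSite2 (a' - 1) (b' - 1)))} (hLB : LB.IsHermitian) {c : ℝ}
    (hcert : ((Real.exp c : ℂ) • cfc Real.exp LB -
      fermionPartialTrace (PolySite.incl (Finset.erase_subset (mkSite2 (a' - 1) (b' - 1)) (rectWindow a' b')))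
        (cfc Real.exp (-((βh : ℂ) • (cornerEnergyRep (rectWindow a' b') (mkSite2 (a' - 1) (b' - 1)) t U μ +
            windowAnnihilator sι (rectWindow a' b') Sw hS zw hzw O g)) +
          fermionEmbed (PolySite.incl (Finset.erase_subset (mkSite2 (a' - 1) (b' - 1)) (rectWindow a' b'))) LB))).PosSemidef) :
    ω.meanEnergy (hubbardTTPrimeFermionInteraction t 0 U) 1 ≤
      ((c - βh * μ * n) - ((q : ℝ) * Real.log q - ∑ s ∈ S, (m s : ℝ) * Real.log (m s) +
        ∑ s ∈ S, (m s : ℝ) * Real.log (z s)) / ((q : ℝ) * a * b)) / (β - βh) := by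
  have hβ : 0 ≤ β := (hβh.trans hlt).le
  refine h.meanEnergy_hubbardTTPrime_le_of_eventually_pressure_bounds hn0 hn2 hLs hβh hlt
    (fun ε hε => eventually_typeFreeEntropy_mul_sq_le_log_partitionFn t 0 U n hβ ha hb S m hq hmS hsum hA hB
      hz0 hz hbox hLs hε)
    (fun ε hε => ?_)
  have hKTI : ∀ (L : ℕ) [NeZero L], ∀ w : TorusSite 2 L,
      relabel (Orb.translate w) (hubbardTorusTT' L t 0 U - (μ : ℂ) • totalNumber) =
        hubbardTorusTT' L t 0 U - (μ : ℂ) • totalNumber := fun L _ w => by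
    rw [hubbardTorusTT'_zero_sub_mu, relabel_translate_hubbardTorusWith]
  exact eventually_log_partitionFn_sectorHamiltonianTT'_le_of_clusterCertificate t U μ βh hn0 hn2 hLs
    (rectCorner_mem_rectWindow (by omega) (by omega)) toLex_le_toLex_rectCorner
    (rectWindow_subset_halfOpenBox_max a' b')
    (fun i => bondWeightSum_cornerBondWeight (rectCorner_mem_rectWindow (by omega) (by omega))
      (rectCorner_sub_unitVec_mem_rectWindow ha' hb' i))
    (siteWeightSum_cornerSiteWeight (rectCorner_mem_rectWindow (by omega) (by omega)))
    (siteWeightSum_mul_cornerSiteWeight (rectCorner_mem_rectWindow (by omega) (by omega)) (-μ))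
    (isHermitian_windowAnnihilator sι _ Sw hS zw hzw hO g)
    (fun L _ hL3 hℓL => trace_window_mul_windowAnnihilator (relabel_translate_gibbsDensity L (hKTI L) βh)
      _ sι Sw hS zw hzw O g) hLB hcert hε

/-- **Lower edge of the thermal energy window from a C2 certificate at `β` and a C1 certificate at a colder
`β_c > β`** (same data as above with the C1 certificate at `(β_c, μ)`):
`((q log q − Σ m_s log m_s + Σ m_s log z_s)/(q a b) − (c − β_c μ n))/(β_c − β) ≤ e_Φ(ω)`.
[cite: Israel1979, Lemma II.3.1] [cite: PoulinHastings2011, eqs. (3)–(8)] [cite: Ruelle1969, §3.3] -/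
theorem IsTorusLimitOfMixture.le_meanEnergy_hubbardTTPrime_of_typeClass_of_rectMarkovCertificate
    (hn0 : 0 ≤ n) (hn2 : n ≤ 2)
    (h : ω.IsTorusLimitOfMixture (sectorGibbsCount n) (fun L => sectorGibbsWeightTT' β t 0 U n L)
      (fun L => sectorGibbsVectorTT' t 0 U n L) Ls)
    (hLs : Tendsto Ls atTop atTop) (hβ : 0 < β) {βc : ℝ} (hlt : β < βc)
    -- C2 at `β`
    {a b : ℕ} (ha : 1 ≤ a) (hb : 1 ≤ b) (S : Finset (ℕ × ℕ)) (m : ℕ × ℕ → ℕ) {q A₀ : ℕ} (hq : 1 ≤ q)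
    (hmS : ∀ s, m s ≠ 0 → s ∈ S) (hsum : ∑ s ∈ S, m s = q) (hA : ∑ s ∈ S, m s * s.1 = A₀)
    (hB : ∑ s ∈ S, m s * s.2 = A₀) {z : ℕ × ℕ → ℝ} (hz0 : ∀ s ∈ S, 0 < z s)
    (hz : ∀ s ∈ S, z s ≤ (partitionFn β (spinSectorHamiltonian s.1 s.2 (hubbardOpenBoxTT' a b t 0 U))).re)
    (hbox : ∀ᶠ j in atTop, ∃ R Kx Ky : ℕ, 2 ≤ Kx ∧ 2 ≤ Ky ∧ Ls j = Kx * a ∧ Ls j = Ky * b ∧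
      Kx * Ky = R * q ∧ halfRectN n (Ls j) = R * A₀)
    -- C1 at `βc`
    (μ : ℝ) {a' b' : ℕ} (ha' : 2 ≤ a') (hb' : 2 ≤ b')
    {ι : Type*} (sι : Finset ι) (Sw : ι → Finset (Site 2)) (hS : ∀ i, Sw i ⊆ rectWindow a' b') (zw : ι → Site 2)
    (hzw : ∀ i, shiftSet (zw i) (Sw i) ⊆ rectWindow a' b') {O : ∀ i, FermionOp (Sw i)}
    (hO : ∀ i ∈ sι, (O i).IsHermitian) (g : ι → ℝ)
    {LB : FermionOp ((rectWindow a' b').erase (mkSite2 (a' - 1) (b' - 1)))} (hLB : LB.IsHermitian) {c : ℝ}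
    (hcert : ((Real.exp c : ℂ) • cfc Real.exp LB -
      fermionPartialTrace (PolySite.incl (Finset.erase_subset (mkSite2 (a' - 1) (b' - 1)) (rectWindow a' b')))
        (cfc Real.exp (-((βc : ℂ) • (cornerEnergyRep (rectWindow a' b') (mkSite2 (a' - 1) (b' - 1)) t U μ +
            windowAnnihilator sι (rectWindow a' b') Sw hS zw hzw O g)) +
          fermionEmbed (PolySite.incl (Finset.erase_subset (mkSite2 (a' - 1) (b' - 1)) (rectWindow a' b'))) LB))).PosSemidef) :
    (((q : ℝ) * Real.log q - ∑ s ∈ S, (m s : ℝ) * Real.log (m s) + ∑ s ∈ S, (m s : ℝ) * Real.log (z s)) /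
        ((q : ℝ) * a * b) - (c - βc * μ * n)) / (βc - β) ≤
      ω.meanEnergy (hubbardTTPrimeFermionInteraction t 0 U) 1 := by
  refine h.le_meanEnergy_hubbardTTPrime_of_eventually_pressure_bounds hn0 hn2 hLs hβ hlt
    (fun ε hε => eventually_typeFreeEntropy_mul_sq_le_log_partitionFn t 0 U n hβ.le ha hb S m hq hmS hsum hA
      hB hz0 hz hbox hLs hε)
    (fun ε hε => ?_)
  have hKTI : ∀ (L : ℕ) [NeZero L], ∀ w : TorusSite 2 L,
      relabel (Orb.translate w) (hubbardTorusTT' L t 0 U - (μ : ℂ) • totalNumber) =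
        hubbardTorusTT' L t 0 U - (μ : ℂ) • totalNumber := fun L _ w => by
    rw [hubbardTorusTT'_zero_sub_mu, relabel_translate_hubbardTorusWith]
  exact eventually_log_partitionFn_sectorHamiltonianTT'_le_of_clusterCertificate t U μ βc hn0 hn2 hLs
    (rectCorner_mem_rectWindow (by omega) (by omega)) toLex_le_toLex_rectCorner
    (rectWindow_subset_halfOpenBox_max a' b')
    (fun i => bondWeightSum_cornerBondWeight (rectCorner_mem_rectWindow (by omega) (by omega))
      (rectCorner_sub_unitVec_mem_rectWindow ha' hb' i))
    (siteWeightSum_cornerSiteWeight (rectCorner_mem_rectWindow (by omega) (by omega)))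
    (siteWeightSum_mul_cornerSiteWeight (rectCorner_mem_rectWindow (by omega) (by omega)) (-μ))
    (isHermitian_windowAnnihilator sι _ Sw hS zw hzw hO g)
    (fun L _ hL3 hℓL => trace_window_mul_windowAnnihilator (relabel_translate_gibbsDensity L (hKTI L) βc)
      _ sι Sw hS zw hzw O g) hLB hcert hε

/-! ### §3 Temperature-RANGE cells: one hot certificate + one `T = 0` row bound a whole interval `β ≥ β₁` -/

/-- **Monotonicity of the Markov-chord bound in the target temperature**: with `A = c − β_h μ n` and a
`T = 0` row value `e⁺`, if `0 ≤ A + β_h e⁺` then `β ↦ (A + β e⁺)/(β − β_h)` is non-increasing on `β > β_h`,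
so its value at `β₁` bounds it for every `β ≥ β₁`. [cite: Israel1979, Lemma II.3.1] -/
theorem markovChordBound_anti {A eup βh β₁ β : ℝ} (hA : 0 ≤ A + βh * eup) (h₁ : βh < β₁) (hβ : β₁ ≤ β) :
    (A + β * eup) / (β - βh) ≤ (A + β₁ * eup) / (β₁ - βh) := by
  have hd₁ : 0 < β₁ - βh := sub_pos.2 h₁
  have hd : 0 < β - βh := lt_of_lt_of_le hd₁ (by linarith)
  rw [div_le_div_iff₀ hd hd₁]
  nlinarith [mul_nonneg hA (sub_nonneg.2 hβ)]

/-- **Temperature-RANGE upper edge from ONE `t–t'` cluster Markov certificate and ONE `T = 0` row** (`t' = 0`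
weighted-cluster form, structured annihilator): for every `β ≥ β₁ > β_h` and every torus limit `ω` of the
canonical sector Gibbs states at `β` (`U ≥ 0`, `0 ≤ n < 2`): `e_Φ(ω) ≤ (c − β_h μ n + β₁ e⁺)/(β₁ − β_h)`,
provided `0 ≤ c − β_h μ n + β_h e⁺` (the bound is then worst at the hottest end `β₁` of the cell). This is the
shape of a phase-map cell over a temperature interval `T ≤ 1/β₁` (`D-0099`).
[cite: Israel1979, Lemma II.3.1] [cite: PoulinHastings2011, eqs. (3)–(8)] -/
theorem IsTorusLimitOfMixture.meanEnergy_hubbardTTPrime_le_on_range_of_clusterMarkovCertificate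
    (hU : 0 ≤ U) (hn0 : 0 ≤ n) (hn2 : n < 2) {β₁ : ℝ} (hβ₁ : β₁ ≤ β)
    (h : ω.IsTorusLimitOfMixture (sectorGibbsCount n) (fun L => sectorGibbsWeightTT' β t 0 U n L)
      (fun L => sectorGibbsVectorTT' t 0 U n L) Ls)
    (hLs : Tendsto Ls atTop atTop) {βh : ℝ} (hβh : 0 < βh) (hlt : βh < β₁)
    (μ : ℝ) {Λ : Finset (Site 2)} {a : Site 2} (ha : a ∈ Λ) (hmax : ∀ y ∈ Λ, toLex y ≤ toLex a)
    {ℓw : ℕ} (hΛ : Λ ⊆ halfOpenBox 2 ℓw)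
    {J : Site 2 → Fin 2 → ℝ} {V μ' : Site 2 → ℝ}
    (hJ : ∀ i, bondWeightSum Λ J i = 1) (hV : siteWeightSum Λ V = 1) (hμ : siteWeightSum Λ μ' = -μ)
    {ι : Type*} (s : Finset ι) (S : ι → Finset (Site 2)) (hS : ∀ i, S i ⊆ Λ) (z : ι → Site 2)
    (hz : ∀ i, shiftSet (z i) (S i) ⊆ Λ) {O : ∀ i, FermionOp (S i)} (hO : ∀ i ∈ s, (O i).IsHermitian)
    (g : ι → ℝ)
    {LB : FermionOp (Λ.erase a)} (hLB : LB.IsHermitian) {c : ℝ}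
    (hcert : ((Real.exp c : ℂ) • cfc Real.exp LB -
      fermionPartialTrace (PolySite.incl (Finset.erase_subset a Λ))
        (cfc Real.exp (-((βh : ℂ) • (clusterHamiltonian Λ t U J V μ' + windowAnnihilator s Λ S hS z hz O g)) +
          fermionEmbed (PolySite.incl (Finset.erase_subset a Λ)) LB))).PosSemidef)
    {eup : ℝ} (he : energyDensityTT' t 0 U n ≤ eup) (hA : 0 ≤ c - βh * μ * n + βh * eup) :
    ω.meanEnergy (hubbardTTPrimeFermionInteraction t 0 U) 1 ≤ (c - βh * μ * n + β₁ * eup) / (β₁ - βh) :=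
  (h.meanEnergy_hubbardTTPrime_le_of_clusterMarkovCertificate_annihilator hU hn0 hn2 hLs hβh (lt_of_lt_of_le hlt hβ₁)
    μ ha hmax hΛ hJ hV hμ s S hS z hz hO g hLB hcert he).trans (markovChordBound_anti hA hlt hβ₁)

end InfVolFermionState

end Literature.MathematicalPhysics.QuantumLattice

end
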